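import Literature.IUT.LogVolume.GenuineRamificationBoundsTower
import Literature.IUT.LogVolume.SubThetaFieldRamificationBound
import Literature.IUT.LogVolume.Theorem110GenuineStepIIPinned
import HarnessLib

/-!
# [IUTchIV] Theorem 1.10, Step (iii) (R4) for the tower of a genuine Θ-volume datum of the cell's reading v3 —
# the L-DH input `hR4` with PRINT's constant `e*_mod = 2^12·3^3·5·e_mod`, `e_mod := d_mod`, NO hypothesis left
# (proof-only; abc-iut cell, campaign S, seat abc-iut-S1)

Mochizuki, *Inter-universal Teichmüller theory IV* (RIMS manuscript Apr. 2020 = PRIMS **57** (2021)), Thm. 1.10, Step (iii)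
(R1)–(R4) p. 25–26 and Step (v) p. 28 ("`4(j+1)·ι_{v_ℚ}·l*_mod`", "`ι_{v_ℚ} = 1` if `p_{v_ℚ} ≤ e*_mod·l`, `= 0` if
`p_{v_ℚ} > e*_mod·l`", `l*_mod = log(e*_mod·l)`, `e*_mod = 2^12·3^3·5·e_mod`, `e_mod ≤ d_mod`).

For a genuine Θ-volume datum of the cell's MODEL READING v3 (abc-iut-S2's `Cor22.ThetaVolumeDatumAt P l`: a field `F`
pinned by `Cor22.IsSubThetaField P F`, an elliptic curve `E/F` with `j(E) = j(λ)`, initial Θ-data `D` — so `K ⊆ F̄` is the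
`l`-torsion field, [IUTchI] Def. 3.1 (c) — and an input `I : ThetaVolumeInput F_mod K`), this file discharges EVERY
hypothesis of abc-iut-S1's `PlaceSection.R4_localFieldFamily_abs` (GenuineRamificationBounds, appendix 3) with print's
constants and `e_mod := d_mod`:
* the crude middle bound `e(v̲ ∩ F | p) ≤ 2^13·3^3·5·d_mod` (`= [F : F_tpd]·[F_tpd : ℚ]`-budget: `IsSubThetaField.finrank_le_bound`,
  `degree_le_six_mul_dmod`);
* the void-branch bound `e(v̲ ∩ F | p) ≤ 2^11·3^3·5·d_mod` at `p > e*_mod·l` (odd!): `e(v̲ ∩ F | v̲ ∩ F_tpd) ≤ 46080`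
  (abc-iut-S1's two-root lemma `Cor22.ramificationIdx_subThetaField_le`) times `e(v̲ ∩ F_tpd | p) ≤ [F_tpd : ℚ] ≤ 6·d_mod`;
* the `K`-layer: `[K:F] ∣ l(l−1)²(l+1)` and `e(v̲ | v̲ ∩ F) ∣ l` off `l` (abc-iut-S-d1's `finrank_dvd_of_ker_le`,
  `exists_ramificationIdx_eq_pow_of_ker_le` over the embedding `K → F̄ ≅ AlgebraicClosure F` of
  `ker_galoisRepTorsion_le_fixingSubgroup_of_initialThetaData`; `l^k ⇒ ∣ l` by `ramificationIdx_dvd_prime_of_eq_pow`).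

* **`Cor22.R4_pinned`** (`ι`-form) / **`Cor22.R4_pinned_explicit`** (`p ≤ d*_mod·l ∧ …`-form) — for `P ∈ U_X`
  minimally presented, `F` pinned… (all instances as in abc-iut-S-d1's
  `Theorem110GenuineStepIIPinned`): at every `v ∈ V(F_mod)_p`, `p − 2 < e(K_{v̲}) ⟹ 3 + log e(K_{v̲}) ≤ 4·ι_p·l*_mod` with
  `ι_p = (p ≤ d*_mod·l ? 1 : 0)`, `l*_mod = log(d*_mod·l)`, `d*_mod = 2^12·3^3·5·d_mod` — LITERALLY the hypothesis `hR4` of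
  abc-iut-c312-d1's `DHData.hullEstimateOf_ofInput_stepV_of_iotaForm` (with `emod := dmod P`, `L := l`), for every `T :
  Cor22.ThetaVolumeDatumAt P l`;
* **`Cor22.ThetaVolumeDatumAt.R4_towerFact`** / **`.R4_iotaForm`** — the bundled forms for `T : ThetaVolumeDatumAt P l`,
  in EXACTLY the shapes of component (γ) of abc-iut-S3's junction `PointDict.hullEstimateOf_BIII_of_towerFacts` and of
  abc-iut-c312-d1's `DHData.hullEstimateOf_ofInput_stepV_of_iotaForm` (statement under the `letI := T.inst…` preamble, as
  in `GenuineTowerFacts`).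

Proof-only (no definition, no named fact, no instance); classical; TAKES NO SIDE on [IUTchIII] Cor. 3.12 — nothing here
concerns `−|log(Θ)|` itself.
-/

noncomputable section

open scoped Classical

namespace Literature.IUT.LogVolume

namespace Cor22

open NumberField IsDedekindDomain Literature.NumberTheory.DiophantineGeometry.GenEll
open Literature.NumberTheory.EllipticCurves Literature.NumberTheory.GaloisRepresentations
open Literature.NumberTheory.NumberFields Literature.IUT.HodgeTheaters WeierstrassCurve IntermediateField Field

section Pinned

variable {P : NFPoint} {F : Type} [Field F] [NumberField F] [Algebra P.F F]
  {K : Type} [Field K] [NumberField K] [Algebra F K]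
  {Fbar : Type} [Field Fbar] [Algebra F Fbar] [Algebra K Fbar]
  {E : WeierstrassCurve F} [hE : E.IsElliptic] {l : ℕ} {Pb : BadPlacePredicates K}

/-- The numeric side conditions of `R4_localFieldFamily_abs` for print's constants with `e_mod := d_mod`:
`2·(2^11·3^3·5·d) ≤ 2^12·3^3·5·d` and `21·(2^13·3^3·5·d) ≤ (2^12·3^3·5·d)^4`.
[cite: Mochizuki2012, IUTchIV Thm 1.10 proof Step (iii) (R4) p.26] -/
private theorem constants_pinned (d : ℕ) :
    2 * (2 ^ 11 * 3 ^ 3 * 5 * d) ≤ 2 ^ 12 * 3 ^ 3 * 5 * d ∧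
      21 * (2 ^ 13 * 3 ^ 3 * 5 * d) ≤ (2 ^ 12 * 3 ^ 3 * 5 * d) ^ 4 := by
  refine ⟨by ring_nf; exact le_rfl, ?_⟩
  have h1 : d ≤ d ^ 4 := Nat.le_self_pow (by norm_num) d
  calc 21 * (2 ^ 13 * 3 ^ 3 * 5 * d) = (21 * (2 ^ 13 * 3 ^ 3 * 5)) * d := by ring
    _ ≤ (2 ^ 12 * 3 ^ 3 * 5) ^ 4 * d ^ 4 := Nat.mul_le_mul (by norm_num) h1
    _ = (2 ^ 12 * 3 ^ 3 * 5 * d) ^ 4 := by ring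

/-- **(R4) for the tower of a genuine Θ-volume datum (reading v3), every hypothesis discharged** ([IUTchIV] Thm. 1.10
Step (iii) (R4) p. 26 / Step (v) p. 28, `e_mod := d_mod`): for `P ∈ U`, a field `F` pinned by `IsSubThetaField P F`, an
elliptic curve `E/F` with `j(E) = j(λ)`, initial Θ-data `D` over `E` (so `F/F_mod` is Galois and `K` is cut out by the
`l`-torsion), and ANY genuine input `I : ThetaVolumeInput F_mod K`: at every `v ∈ V(F_mod)_p`,
`p − 2 < e(K_{v̲}) ⟹ 3 + log e(K_{v̲}) ≤ 4·ι_p·l*_mod` (`ι_p = (p ≤ d*_mod·l ? 1 : 0)`, `l*_mod = log(d*_mod·l)`,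
`d*_mod = 2^12·3^3·5·d_mod`). [cite: Mochizuki2012, IUTchIV Thm 1.10 proof Step (iii) (R4) p.26]
[cite: Mochizuki2012, IUTchIV Thm 1.10 proof Step (v) p.28] -/
theorem R4_pinned (hP : P ∈ UP) (hF : IsSubThetaField P F) (hj : E.j = algebraMap P.F F (jInv P.x))
    (D : InitialThetaData F K Fbar E l Pb) (I : ThetaVolumeInput (fieldOfModuli E) K) {p : ℕ} [hp : Fact p.Prime]
    (v : placesOver (fieldOfModuli E) p) :
    p - 2 < absRamificationIdx p ((I.σ.localFieldFamily p hp.out).k v) →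
      3 + Real.log (absRamificationIdx p ((I.σ.localFieldFamily p hp.out).k v)) ≤
        4 * (if p ≤ 2 ^ 12 * 3 ^ 3 * 5 * dmod P * l then (1 : ℝ) else 0) *
          Real.log (((2 ^ 12 * 3 ^ 3 * 5 * dmod P : ℕ) : ℝ) * l) := by
  have hU : P.InU := hP.1
  have hl : l.Prime := D.l_prime
  haveI : Fact l.Prime := ⟨hl⟩
  haveI := D.isScalarTower
  haveI := D.isAlgClosure
  haveI := D.isGalois_fieldOfModuli
  haveI : IsGalois P.F F := isGalois_tpd_of_isGalois_fieldOfModuli hj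
  haveI : IsGalois F K := isGalois_F_K_of_initialThetaData D
  -- the embedding `K → AlgebraicClosure F` inside the `l`-division field
  let ι : Fbar ≃ₐ[F] AlgebraicClosure F := IsAlgClosure.equiv F Fbar (AlgebraicClosure F)
  let ψ : K →ₐ[F] AlgebraicClosure F :=
    (ι : Fbar →ₐ[F] AlgebraicClosure F).comp (IsScalarTower.toAlgHom F K Fbar)
  have hK : (E.galoisRepTorsion (l : ℤ)).ker ≤ ψ.fieldRange.fixingSubgroup :=
    ker_galoisRepTorsion_le_fixingSubgroup_of_initialThetaData D ι
  have hss : E.IsSemistable (𝓞 F) := D.isSemistable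
  have hdmod : 1 ≤ dmod P := by unfold dmod; exact Module.finrank_pos
  -- the places: `u = v̲` of `K`, `w = u ∩ F`, `w ∩ F_tpd`
  set u : HeightOneSpectrum (𝓞 K) := I.σ.lift v.1 with hu
  set w : HeightOneSpectrum (𝓞 F) := finBelow F K u with hw
  have hpu : ((p : ℕ) : 𝓞 K) ∈ u.asIdeal := I.σ.natCast_mem_lift v
  have hpw : ((p : ℕ) : 𝓞 F) ∈ w.asIdeal := by
    change ((p : ℕ) : 𝓞 F) ∈ u.asIdeal.under (𝓞 F)
    rw [Ideal.under_def, Ideal.mem_comap, map_natCast]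
    exact hpu
  -- the middle layer's absolute index: `e(w | p) = e(w ∩ F_tpd | p) · e(w | w ∩ F_tpd)`
  have htower : w.asIdeal.ramificationIdx ℤ =
      (w.asIdeal.under (𝓞 P.F)).ramificationIdx ℤ * w.asIdeal.ramificationIdx (𝓞 P.F) :=
    Ideal.ramificationIdx_tower (R := ℤ) (w.asIdeal.under (𝓞 P.F)) w.asIdeal
  have htpd : (w.asIdeal.under (𝓞 P.F)).ramificationIdx ℤ ≤ 6 * dmod P :=
    (ramificationIdx_int_le_finrank_rat (finBelow P.F F w)).trans (degree_le_six_mul_dmod P hP)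
  -- crude bound: `e(w | F_tpd) ≤ [F : F_tpd] ≤ 2²·46080`
  have hcrude : (u.asIdeal.under (𝓞 F)).ramificationIdx ℤ ≤ 2 ^ 13 * 3 ^ 3 * 5 * dmod P := by
    change w.asIdeal.ramificationIdx ℤ ≤ _
    rw [htower]
    calc (w.asIdeal.under (𝓞 P.F)).ramificationIdx ℤ * w.asIdeal.ramificationIdx (𝓞 P.F)
        ≤ (6 * dmod P) * (2 ^ 2 * 46080) :=
          Nat.mul_le_mul htpd ((ramificationIdx_rel_le_finrank w).trans (hF.finrank_le_bound P hU))
      _ = 2 ^ 13 * 3 ^ 3 * 5 * dmod P := by ring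
  -- void-branch bound at the (odd) primes `p > d*_mod·l`: the two-root lemma
  have hbig : 2 ^ 12 * 3 ^ 3 * 5 * dmod P * l < p →
      (u.asIdeal.under (𝓞 F)).ramificationIdx ℤ ≤ 2 ^ 11 * 3 ^ 3 * 5 * dmod P := by
    intro hbigp
    have hp2 : p ≠ 2 := by
      intro h; subst h
      have h2l : 2 ^ 12 * 3 ^ 3 * 5 * 1 * 2 ≤ 2 ^ 12 * 3 ^ 3 * 5 * dmod P * l :=
        Nat.mul_le_mul (Nat.mul_le_mul_left _ hdmod) hl.two_le
      omega
    have h2 : ((2 : ℕ) : 𝓞 P.F) ∉ (finBelow P.F F w).asIdeal :=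
      natCast_not_mem_under_of_ne (F := P.F) w hp.out Nat.prime_two hpw hp2
    change w.asIdeal.ramificationIdx ℤ ≤ _
    rw [htower]
    calc (w.asIdeal.under (𝓞 P.F)).ramificationIdx ℤ * w.asIdeal.ramificationIdx (𝓞 P.F)
        ≤ (6 * dmod P) * 46080 := Nat.mul_le_mul htpd (ramificationIdx_subThetaField_le F hU hF w h2)
      _ = 2 ^ 11 * 3 ^ 3 * 5 * dmod P := by ring
  -- the `K`-layer
  have hKF : Module.finrank F K ∣ l * (l - 1) ^ 2 * (l + 1) := finrank_dvd_of_ker_le ψ hK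
  have htame : ((l : ℕ) : 𝓞 F) ∉ u.asIdeal.under (𝓞 F) → u.asIdeal.ramificationIdx (𝓞 F) ∣ l := by
    intro hlu
    obtain ⟨k, hk⟩ := exists_ramificationIdx_eq_pow_of_ker_le ψ hss hj hl hK u hlu
    exact ramificationIdx_dvd_prime_of_eq_pow u hl hk hKF
  obtain ⟨hNb, hNc⟩ := constants_pinned (dmod P)
  exact I.σ.R4_localFieldFamily_abs (F := F) v hNb hNc hcrude hbig hl hKF htame

/-- **(R4), explicit shape** (the `hR4` of abc-iut-c312-d1's `DHData.hullEstimateOf_ofInput_explicit` with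
`N := d*_mod·l`, `lmod := log(d*_mod·l)`, and component (γ) of abc-iut-S3's junction `hullEstimateOf_BIII_of_towerFacts`):
under the hypotheses of `R4_pinned`, `p − 2 < e(K_{v̲})` FORCES `p ≤ d*_mod·l` (the void branch `ι_p = 0` of Step (v)
p. 28 is genuinely void: `3 + log e ≤ 0` is absurd) and `3 + log e(K_{v̲}) ≤ 4·log(d*_mod·l)`.
[cite: Mochizuki2012, IUTchIV Thm 1.10 proof Step (iii) (R4) p.26] [cite: Mochizuki2012, IUTchIV Thm 1.10 proof Step (v) p.28] -/
theorem R4_pinned_explicit (hP : P ∈ UP) (hF : IsSubThetaField P F) (hj : E.j = algebraMap P.F F (jInv P.x))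
    (D : InitialThetaData F K Fbar E l Pb) (I : ThetaVolumeInput (fieldOfModuli E) K) {p : ℕ} [hp : Fact p.Prime]
    (v : placesOver (fieldOfModuli E) p)
    (hpe : p - 2 < absRamificationIdx p ((I.σ.localFieldFamily p hp.out).k v)) :
    p ≤ 2 ^ 12 * 3 ^ 3 * 5 * dmod P * l ∧
      3 + Real.log (absRamificationIdx p ((I.σ.localFieldFamily p hp.out).k v)) ≤
        4 * Real.log (((2 ^ 12 * 3 ^ 3 * 5 * dmod P : ℕ) : ℝ) * l) := by
  have h := R4_pinned hP hF hj D I v hpe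
  by_cases hle : p ≤ 2 ^ 12 * 3 ^ 3 * 5 * dmod P * l
  · rw [if_pos hle, mul_one] at h
    exact ⟨hle, h⟩
  · exfalso
    rw [if_neg hle, mul_zero, zero_mul] at h
    have h0 : (0 : ℝ) ≤ Real.log (absRamificationIdx p ((I.σ.localFieldFamily p hp.out).k v)) :=
      Real.log_natCast_nonneg _
    linarith

end Pinned

/-! ### The bundled forms, for a genuine Θ-volume datum `T : ThetaVolumeDatumAt P l` (reading v3) -/

namespace ThetaVolumeDatumAt

variable {P : NFPoint} {l : ℕ} (T : ThetaVolumeDatumAt P l)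

/-- **(R4) for EVERY genuine Θ-volume datum, junction shape** — LITERALLY component (γ) `hR4` of abc-iut-S3's
`PointDict.hullEstimateOf_BIII_of_towerFacts` (= the `hR4` of abc-iut-c312-d1's `DHData.hullEstimateOf_ofInput_explicit
T.I (2^12·3^3·5·d_mod·l)` with `lmod := log((2^12·3^3·5·d_mod)·l)`), for `λ ∈ U_X` minimally presented: NO residual
hypothesis (the membership `p ∈ T(I)` is not even used). [cite: Mochizuki2012, IUTchIV Thm 1.10 proof Step (iii) (R4) p.26]
[cite: Mochizuki2012, IUTchIV Thm 1.10 proof Step (v) p.28] -/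
theorem R4_towerFact (hP : P ∈ UP) :
    (letI := T.instFieldF; letI := T.instNumberFieldF; letI := T.instAlgebraF; letI := T.instFieldK
     letI := T.instNumberFieldK; letI := T.instAlgebraK; letI := T.instFieldFbar; letI := T.instAlgebraFbar
     letI := T.instAlgebraKFbar; letI := T.instIsElliptic
     ∀ (p : ℕ) [hp : Fact p.Prime], p ∈ T.I.supportPrimes → ∀ v : placesOver (fieldOfModuli T.E) p,
       p - 2 < absRamificationIdx p ((T.I.σ.localFieldFamily p hp.out).k v) →
         p ≤ 2 ^ 12 * 3 ^ 3 * 5 * Cor22.dmod P * l ∧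
           3 + Real.log (absRamificationIdx p ((T.I.σ.localFieldFamily p hp.out).k v)) ≤
             4 * Real.log (((2 ^ 12 * 3 ^ 3 * 5 * Cor22.dmod P : ℕ) : ℝ) * l)) := by
  letI := T.instFieldF; letI := T.instNumberFieldF; letI := T.instAlgebraF; letI := T.instFieldK
  letI := T.instNumberFieldK; letI := T.instAlgebraK; letI := T.instFieldFbar; letI := T.instAlgebraFbar
  letI := T.instAlgebraKFbar; letI := T.instIsElliptic
  intro p hp _ v hpe
  exact R4_pinned_explicit hP T.isSubThetaField T.j_eq T.D T.I v hpe

/-- **(R4) for EVERY genuine Θ-volume datum, `ι`-form** — LITERALLY the `hR4` of abc-iut-c312-d1's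
`DHData.hullEstimateOf_ofInput_stepV_of_iotaForm` / `logμ_hullUTheta_ofInput_le_collBoundMin` at `T.I` with
`emod := d_mod`, `L := l` (print's `ι_{v_ℚ}·l*_mod`, Step (v) p. 28), for `λ ∈ U_X` minimally presented.
[cite: Mochizuki2012, IUTchIV Thm 1.10 proof Step (iii) (R4) p.26] [cite: Mochizuki2012, IUTchIV Thm 1.10 proof Step (v) p.28] -/
theorem R4_iotaForm (hP : P ∈ UP) :
    (letI := T.instFieldF; letI := T.instNumberFieldF; letI := T.instAlgebraF; letI := T.instFieldK
     letI := T.instNumberFieldK; letI := T.instAlgebraK; letI := T.instFieldFbar; letI := T.instAlgebraFbar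
     letI := T.instAlgebraKFbar; letI := T.instIsElliptic
     ∀ (p : ℕ) [hp : Fact p.Prime], p ∈ T.I.supportPrimes → ∀ v : placesOver (fieldOfModuli T.E) p,
       p - 2 < absRamificationIdx p ((T.I.σ.localFieldFamily p hp.out).k v) →
         3 + Real.log (absRamificationIdx p ((T.I.σ.localFieldFamily p hp.out).k v)) ≤
           4 * (if p ≤ 2 ^ 12 * 3 ^ 3 * 5 * Cor22.dmod P * l then (1 : ℝ) else 0) *
             Real.log (((2 ^ 12 * 3 ^ 3 * 5 * Cor22.dmod P : ℕ) : ℝ) * l)) := by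
  letI := T.instFieldF; letI := T.instNumberFieldF; letI := T.instAlgebraF; letI := T.instFieldK
  letI := T.instNumberFieldK; letI := T.instAlgebraK; letI := T.instFieldFbar; letI := T.instAlgebraFbar
  letI := T.instAlgebraKFbar; letI := T.instIsElliptic
  intro p hp _ v hpe
  exact R4_pinned hP T.isSubThetaField T.j_eq T.D T.I v hpe

end ThetaVolumeDatumAt

end Cor22

end Literature.IUT.LogVolume

end
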